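import Literature.NumberTheory.GelbartRogawski1991.LocalSplittingCMParabolicEigenfunctional
import Literature.NumberTheory.GelbartRogawski1991.LocalUnitaryBlockRestriction
import Literature.NumberTheory.GelbartRogawski1991.LocalDoubledUnitarySiegel
import HarnessLib

/-!
# The diagonal `i(g, g)` of the doubled unitary group lies in the Siegel parabolic `P_Δ`: block bookkeeping and the
# diagonal eigen-law of Kudla's CM splitting on product vectors (the local doubling kernel identity, group level)

Topic `NumberTheory/GelbartRogawski1991`; namespace `Literature.NumberTheory.GelbartRogawski1991.UnitaryDualPair.LocalSplitting`
(that of `LocalDoubledUnitaryDatum`, `LocalUnitaryBlockRestriction`, `LocalSplittingCMParabolicEigenfunctional`).  KERNEL MATHEMATICS: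
two small definitions with bodies (`toNegForm`, `diagD`) + theorems; no named fact, no `sorry`, no instance, no notation.
Cell `hodgecm-mathlib` (D-0151), fan B, L1ns road (P) of the crux hLiu418 — brick B1 of the «doubling relation (D)» (memo
`F0/P6/B-p04/g44/MEMO-L1ns-road.v3.B-p04g44.md`); `--supports stmt-HodgeConjecture-24832`, count-neutral.

SETTING: `E/F` CM-type quadratic data `(c, δ, d)`, a finite place `v`, a symmetric invertible `T₀ ∈ M_n(F)`, `J = T₀ ⊗ 1`, the second copy
`J′ = (−T₀) ⊗ 1 = −J`, the doubled group `H(F_v) = U(J^𝔻)(F_v)`, `J^𝔻 = (T₀ ⊕ −T₀) ⊗ 1` (★ `gramD`, which IS the tree's `finSum n n T₀ (−T₀)`: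
`gramD_eq_finSum`, `rfl`), its Siegel parabolic `P_Δ` (★ `IsSiegelDelta`, `deltaBlock`, `detDelta`, `chiDet`) and the two block embeddings
★ `BlockSum.inlLoc` ∕ `BlockSum.inrLoc` with the block restrictions ★ `BlockSum.restrictLeft` ∕ `restrictRight` of a section.

* §0 `localPi_neg_eq` — `U(−J)(F_v) = U(J)(F_v)` as subgroups of `Π_{w∣v} GL_n(E_w)`; `toNegForm : U(J)(F_v) ≃* U(−J)(F_v)` (Mathlib's
  `MulEquiv.subgroupCongr`, same matrices); **the diagonal `diagD g := (g ⊕ 1)(1 ⊕ g)`** and its bookkeeping: `diagD_apply`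
  (`i(g,g)_w = reindex (g_w ⊕ g_w)`), **`isSiegelDelta_diagD`** (`i(g,g) ∈ P_Δ`), `deltaBlock_diagD` ∕ **`detDelta_diagD`** (`det_Δ i(g,g)_w = det g_w`),
  **`chiDet_diagD`** (`χ_v(det_Δ i(g,g)) = ∏_w χ_w(det g_w)`) — the local twins of the adelic ★ `isSiegelDelta_diagG` ∕ `detDelta_diagG`
  (`DoubledUnitaryDiagonalEmbedding`).
* §1 (CM data: `L` CM, `χ` with `IsSplittingChar L 1 χ`, `s^𝔻 = (localSplittingDatumCM L v μ n … χ hχ).localSplitting`, `m₀` an implementer carrying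
  `ℓ_Δ` onto `ℓ_Y`) **`apply_zero_toRep_localSplitting_diagD`** — the `Δ`-functional `Φ ↦ (ω^𝔻(m₀) Φ)(0)` is an eigenfunctional of `ω^𝔻(s^𝔻 i(g,g))`
  with the parabolic scalar `χ_v(det_Δ i(g,g))⁻¹ ∏_w ‖det_Δ‖_w^{1/2}` (★ `apply_zero_toRep_mul_localSplitting_eq_mul` at `w₀ = 1`), and its PRODUCT FORM
  **`apply_zero_toRep_boxSB_restrict_diagD`**: `(ω^𝔻(m₀)(ω(s₁ g) f₁ ⊠ ω(s₂ g) f₂))(0) = (that scalar) · (ω^𝔻(m₀)(f₁ ⊠ f₂))(0)` for the block restrictions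
  `s₁ = restrictLeft s^𝔻`, `s₂ = restrictRight s^𝔻 ∘ toNegForm` (★ `BlockSum.toRep_inlLoc_mul_inrLoc_boxSB`) — the group-level form of the doubling
  see-saw identity «`f_Φ(i(g,g)) = χ(det g)·Φ-pairing`» ([Kudla1994, §3 Thm. 3.1]; [HarrisKudlaSweet1996, §1 (1.11)–(1.16)]).

Consumer (next bricks): the non-degeneracy of `(f₁, f₂) ↦ (ω^𝔻(m₀)(f₁ ⊠ f₂))(0)` and the duality of block types «types(s₂) = (χ_v∘det)·types(s₁)⁻¹».
HC_CM is NOT proved here and is proved only modulo the printed citations (2 remaining named inputs hLiu418, h413) until rung 0 closes.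

## References
* [Kudla1994] S. Kudla, *Splitting metaplectic covers of dual reductive pairs*, Israel J. Math. 87 (1994), §2 (doubled space, Siegel parabolic), §3 Thm. 3.1.
* [HarrisKudlaSweet1996] M. Harris, S. Kudla, W. Sweet, *Theta dichotomy for unitary groups*, J. AMS 9 (1996), §1 (1.9)–(1.16).
* [MoeglinVignerasWaldspurger1987] C. Mœglin, M.-F. Vignéras, J.-L. Waldspurger, LNM 1291 (1987), Chap. 2 II.1 Rem. (6).
* [Kudla1984] S. Kudla, *Seesaw dual reductive pairs*, Progr. Math. 46 (1984), §1.
-/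

set_option autoImplicit false

noncomputable section

open scoped Matrix
open NumberField IsDedekindDomain MeasureTheory Matrix
open Literature.RepresentationTheory.HeisenbergGroup
open Literature.NumberTheory.Automorphic Literature.NumberTheory.Automorphic.UnitaryGroup Literature.NumberTheory.Weil1964
open Literature.NumberTheory.GaloisRepresentations Literature.RepresentationTheory.HarrisKudlaSweet1996

namespace Literature.NumberTheory.GelbartRogawski1991.UnitaryDualPair.LocalSplitting

/-! ## §0 The second copy `U(−T₀ ⊗ 1)(F_v) = U(T₀ ⊗ 1)(F_v)` and the diagonal `i(g, g)` -/

section Generic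

variable (F : Type) [Field F] [NumberField F] (E : Type) [Field E] [NumberField E] [Algebra F E]
  [Algebra.IsQuadraticExtension F E] (c : E ≃ₐ[F] E)
  {δ : E} (hcδ : c δ = -δ) (hδ : δ ≠ 0) {d : F} (hd : δ * δ = algebraMap F E d)
  (v : HeightOneSpectrum (𝓞 F)) (n : ℕ) {T₀ : Matrix (Fin n) (Fin n) F} (hT₀ : T₀.IsSymm) (hT₀d : IsUnit T₀.det)
  {J : Matrix (Fin n) (Fin n) E} (hJ : J = T₀.map (algebraMap F E))
  {J' : Matrix (Fin n) (Fin n) E} (hJ' : J' = (-T₀).map (algebraMap F E))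
  {JD : Matrix (Fin (n + n)) (Fin (n + n)) E} (hJD : JD = (gramD F n T₀).map (algebraMap F E))

omit [NumberField F] [Algebra.IsQuadraticExtension F E] in
/-- `T^𝔻 = T₀ ⊕ᶠ (−T₀)`: the doubled Gram matrix IS the tree's `finSum` (definitionally). [cite: HarrisKudlaSweet1996, §1 (1.9)] -/
theorem gramD_eq_finSum : gramD F n T₀ = UnitaryGroup.finSum n n T₀ (-T₀) := rfl

omit [NumberField F] [NumberField E] [Algebra.IsQuadraticExtension F E] in
include hJD in
/-- `J^𝔻 = (T₀ ⊕ᶠ (−T₀)) ⊗ 1`. [cite: HarrisKudlaSweet1996, §1 (1.9)] -/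
theorem hJD_finSum : JD = (UnitaryGroup.finSum n n T₀ (-T₀)).map (algebraMap F E) := hJD

omit [NumberField F] [NumberField E] [Algebra.IsQuadraticExtension F E] in
include hJ hJ' in
/-- `(−T₀) ⊗ 1 = −(T₀ ⊗ 1)`. [cite: Kudla1994, §2 (doubled space, Siegel parabolic)] -/
theorem hJ'_neg : J' = -J := by
  rw [hJ', hJ, Matrix.map_neg _ (map_neg (algebraMap F E))]

omit [Algebra.IsQuadraticExtension F E] in
include hJ hJ' in
/-- **`U(−J)(F_v) = U(J)(F_v)`** as subgroups of `Π_{w ∣ v} GL_n(E_w)`: the unitary condition for `−J` is that for `J`.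
[cite: Kudla1994, §2] -/
theorem localPi_neg_eq : localPi E c n J' v = localPi E c n J v := by
  ext u
  rw [mem_localPi_iff, mem_localPi_iff]
  refine forall_congr' fun w => ?_
  rw [hJ'_neg F E n hJ hJ', show placeForm (-J) w.1 = -placeForm J w.1 from Matrix.map_neg _ (map_neg _) _,
    Matrix.mul_neg, Matrix.neg_mul, neg_inj]

/-- **the identity `U(J)(F_v) ≃* U(−J)(F_v)`** (same matrices; Mathlib's `MulEquiv.subgroupCongr`). [cite: Kudla1994, §2] -/
def toNegForm : localPi E c n J v ≃* localPi E c n J' v :=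
  MulEquiv.subgroupCongr (localPi_neg_eq F E c v n hJ hJ').symm

omit [Algebra.IsQuadraticExtension F E] in
/-- components of `toNegForm g` are those of `g`. [cite: Kudla1994, §2] -/
theorem coe_toNegForm (g : localPi E c n J v) :
    ((toNegForm F E c v n hJ hJ' g : localPi E c n J' v) : LocalGLPi E n v) = (g : LocalGLPi E n v) :=
  MulEquiv.subgroupCongr_apply _ _

/-- **the diagonal `i(g, g) = (g ⊕ 1)(1 ⊕ g)` of the doubled group `H = U(T₀ ⊕ −T₀)(F_v)`.**
[cite: Kudla1994, §2 (doubled space, Siegel parabolic)] -/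
def diagD (g : localPi E c n J v) : localPi E c (n + n) JD v :=
  BlockSum.inlLoc F E c v n n hJ (hJD_finSum F E n hJD) g *
    BlockSum.inrLoc F E c v n n hJ' (hJD_finSum F E n hJD) (toNegForm F E c v n hJ hJ' g)

omit [Algebra.IsQuadraticExtension F E] in
/-- **components of the diagonal**: `i(g,g)_w = reindex_{e₂} (g_w ⊕ g_w)`. [cite: Kudla1994, §2] -/
theorem diagD_apply (g : localPi E c n J v) (w : PlacesOver E v) :
    (((diagD F E c v n hJ hJ' hJD g : localPi E c (n + n) JD v) : LocalGLPi E (n + n) v) w :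
        Matrix (Fin (n + n)) (Fin (n + n)) (w.1.adicCompletion E)) =
      Matrix.reindex (e₂ n) (e₂ n)
        (Matrix.fromBlocks (((g : LocalGLPi E n v) w : GL (Fin n) (w.1.adicCompletion E)) : Matrix (Fin n) (Fin n) _) 0 0
          (((g : LocalGLPi E n v) w : GL (Fin n) (w.1.adicCompletion E)) : Matrix (Fin n) (Fin n) _)) := by
  rw [diagD, Subgroup.coe_mul, Pi.mul_apply, Units.val_mul, BlockSum.inlLoc_apply, BlockSum.inrLoc_apply,
    UnitaryGroup.coe_reindexGL, UnitaryGroup.coe_blockDiagGL, UnitaryGroup.coe_reindexGL, UnitaryGroup.coe_blockDiagGL,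
    coe_toNegForm, Units.val_one, Matrix.reindex_apply, Matrix.reindex_apply, Matrix.submatrix_mul_equiv,
    Matrix.fromBlocks_multiply]
  simp only [Matrix.mul_zero, Matrix.zero_mul, add_zero, zero_add, Matrix.mul_one, Matrix.one_mul, Matrix.reindex_apply]

omit [Algebra.IsQuadraticExtension F E] in
/-- the `e₂`-blocks of the diagonal. [cite: Kudla1994, §2] -/
theorem reindex_symm_diagD (g : localPi E c n J v) (w : PlacesOver E v) :
    Matrix.reindex (e₂ n).symm (e₂ n).symm
        ((((diagD F E c v n hJ hJ' hJD g : localPi E c (n + n) JD v) : LocalGLPi E (n + n) v) w :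
          Matrix (Fin (n + n)) (Fin (n + n)) (w.1.adicCompletion E))) =
      Matrix.fromBlocks (((g : LocalGLPi E n v) w : GL (Fin n) (w.1.adicCompletion E)) : Matrix (Fin n) (Fin n) _) 0 0
        (((g : LocalGLPi E n v) w : GL (Fin n) (w.1.adicCompletion E)) : Matrix (Fin n) (Fin n) _) := by
  rw [diagD_apply, Matrix.reindex_apply, Matrix.reindex_apply, Matrix.submatrix_submatrix, Equiv.symm_symm,
    Equiv.symm_comp_self, Matrix.submatrix_id_id]

/-- **`i(g, g) ∈ P_Δ(F_v)`**: the diagonal stabilises `ℓ_Δ` (block condition `g + 0 = 0 + g`).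
[cite: Kudla1994, §2 (doubled space, Siegel parabolic)] [cite: HarrisKudlaSweet1996, §1 (1.11)–(1.12)] -/
theorem isSiegelDelta_diagD (g : localPi E c n J v) :
    IsSiegelDelta F E c hcδ hδ hd v n hT₀ hJD (diagD F E c v n hJ hJ' hJD g) := by
  rw [isSiegelDelta_iff_blocks]
  intro w
  rw [reindex_symm_diagD, Matrix.toBlocks_fromBlocks₁₁, Matrix.toBlocks_fromBlocks₁₂, Matrix.toBlocks_fromBlocks₂₁,
    Matrix.toBlocks_fromBlocks₂₂, add_zero, zero_add]

omit [Algebra.IsQuadraticExtension F E] in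
/-- **`(i(g,g))_Δ = g_w`**: the action of the diagonal on `Δ ≅ E_w^n`. [cite: Kudla1994, §3] -/
theorem deltaBlock_diagD (g : localPi E c n J v) (w : PlacesOver E v) :
    deltaBlock F E c v n w (diagD F E c v n hJ hJ' hJD g) =
      (((g : LocalGLPi E n v) w : GL (Fin n) (w.1.adicCompletion E)) : Matrix (Fin n) (Fin n) _) := by
  simp only [deltaBlock]
  rw [reindex_symm_diagD, Matrix.toBlocks_fromBlocks₁₁, Matrix.toBlocks_fromBlocks₁₂, add_zero]

omit [Algebra.IsQuadraticExtension F E] in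
/-- **`det_Δ i(g,g)_w = det g_w`**. [cite: Kudla1994, §3] [cite: HarrisKudlaSweet1996, §1 (1.11)–(1.12)] -/
theorem detDelta_diagD (g : localPi E c n J v) (w : PlacesOver E v) :
    detDelta F E c v n w (diagD F E c v n hJ hJ' hJD g) =
      ((((g : LocalGLPi E n v) w : GL (Fin n) (w.1.adicCompletion E)) : Matrix (Fin n) (Fin n) _)).det := by
  rw [detDelta, deltaBlock_diagD]

omit [Algebra.IsQuadraticExtension F E] in
/-- **`χ_v(det_Δ i(g,g)) = ∏_w χ_w(det g_w)`**. [cite: HarrisKudlaSweet1996, §1 (1.15)] -/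
theorem chiDet_diagD (χv : ∀ w : PlacesOver E v, (w.1.adicCompletion E)ˣ →* ℂˣ) (g : localPi E c n J v) :
    chiDet F E c v n χv (diagD F E c v n hJ hJ' hJD g) =
      ∏ w : PlacesOver E v, χv w (Matrix.GeneralLinearGroup.det ((g : LocalGLPi E n v) w)) := by
  classical
  unfold chiDet
  refine Finset.prod_congr rfl fun w _ => ?_
  have hu : IsUnit (detDelta F E c v n w (diagD F E c v n hJ hJ' hJD g)) := by
    rw [detDelta_diagD]; exact ((g : LocalGLPi E n v) w).isUnit.map Matrix.detMonoidHom
  rw [dif_pos hu]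
  congr 1
  exact Units.ext (by rw [IsUnit.unit_spec, detDelta_diagD, Matrix.GeneralLinearGroup.val_det_apply])

omit [NumberField F] in
/-- `det (−T₀)` is a unit when `det T₀` is. [cite: HarrisKudlaSweet1996, §1 (1.9)] -/
theorem isUnit_det_neg_of_isUnit {T₀ : Matrix (Fin n) (Fin n) F} (hT₀d : IsUnit T₀.det) : IsUnit (-T₀).det := by
  rw [Matrix.det_neg]
  exact ((isUnit_one.neg).pow _).mul hT₀d

end Generic

/-! ## §1 The diagonal eigen-law of Kudla's CM splitting and its product form -/

section CM

variable (L : Type) [Field L] [NumberField L] [IsCMField L] (v : HeightOneSpectrum (𝓞 (maximalRealSubfield L)))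
  [MeasurableSpace (v.adicCompletion (maximalRealSubfield L))] [BorelSpace (v.adicCompletion (maximalRealSubfield L))]
  (μ : Measure (v.adicCompletion (maximalRealSubfield L))) [μ.IsAddHaarMeasure]
  (n : ℕ) {T₀ : Matrix (Fin n) (Fin n) (maximalRealSubfield L)} (hT₀ : T₀.IsSymm) (hT₀d : IsUnit T₀.det)
  (χ : HeckeCharacter L) (hχ : IsSplittingChar L 1 χ)
  (m₀ : LocalMp (maximalRealSubfield L) (n + n) (gramD (maximalRealSubfield L) n T₀) v)
  (hm₀ : (deltaLagrangian (maximalRealSubfield L) v n).map (toLin (maximalRealSubfield L) v (MpPsi.proj _ m₀)) =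
    lagrangianY (maximalRealSubfield L) (n + n) v)
  {J : Matrix (Fin n) (Fin n) L} (hJ : J = T₀.map (algebraMap (maximalRealSubfield L) L))
  {J' : Matrix (Fin n) (Fin n) L} (hJ' : J' = (-T₀).map (algebraMap (maximalRealSubfield L) L))

include hm₀ in
set_option maxHeartbeats 4000000 in -- the doubled CM datum's telescope (as in ★ `LocalSplittingCMParabolicEigenfunctional`)
/-- **THE DIAGONAL EIGEN-LAW** of the `Δ`-functional `Φ ↦ (ω^𝔻(m₀) Φ)(0)` (`m₀` any implementer carrying `ℓ_Δ` onto `ℓ_Y`):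
`(ω^𝔻(m₀) (ω^𝔻(s^𝔻 i(g,g)) Φ))(0) = χ_v(det_Δ i(g,g))⁻¹ · ∏_w ‖det_Δ i(g,g)_w‖^{1/2} · (ω^𝔻(m₀) Φ)(0)` for every
`g ∈ U(T₀ ⊗ 1)(L⁺_v)` — ★ `apply_zero_toRep_mul_localSplitting_eq_mul` at `w₀ = 1`, `p′ = i(g,g) ∈ P_Δ`
(`isSiegelDelta_diagD`). [cite: Kudla1994, §3 Thm. 3.1] [cite: HarrisKudlaSweet1996, §1 (1.16)] -/
theorem apply_zero_toRep_localSplitting_diagD (g : localPi L (IsCMField.complexConj L) n J v)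
    (Φ : SchwartzBruhat (Fin (n + n) → v.adicCompletion (maximalRealSubfield L))) :
    ((MpPsi.toRep (localSchrodinger (maximalRealSubfield L) (n + n) (gramD (maximalRealSubfield L) n T₀) v) m₀
          (MpPsi.toRep (localSchrodinger (maximalRealSubfield L) (n + n) (gramD (maximalRealSubfield L) n T₀) v)
            ((localSplittingDatumCM L v μ n hT₀ hT₀d rfl χ hχ).localSplitting
              (diagD (maximalRealSubfield L) L (IsCMField.complexConj L) v n hJ hJ' rfl g)) Φ) :
        SchwartzBruhat (Fin (n + n) → v.adicCompletion (maximalRealSubfield L))) :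
        (Fin (n + n) → v.adicCompletion (maximalRealSubfield L)) → ℂ) 0 =
      (((chiDet (maximalRealSubfield L) L (IsCMField.complexConj L) v n
            (fun w' : PlacesOver L v => (χ.localComponent w'.1)⁻¹)
            (diagD (maximalRealSubfield L) L (IsCMField.complexConj L) v n hJ hJ' rfl g))⁻¹ : ℂˣ) : ℂ) *
        ((∏ w' : PlacesOver L v,
            Real.sqrt ‖detDelta (maximalRealSubfield L) L (IsCMField.complexConj L) v n w'
              (diagD (maximalRealSubfield L) L (IsCMField.complexConj L) v n hJ hJ' rfl g)‖ : ℝ) : ℂ) *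
        ((MpPsi.toRep (localSchrodinger (maximalRealSubfield L) (n + n) (gramD (maximalRealSubfield L) n T₀) v) m₀ Φ :
          SchwartzBruhat (Fin (n + n) → v.adicCompletion (maximalRealSubfield L))) :
          (Fin (n + n) → v.adicCompletion (maximalRealSubfield L)) → ℂ) 0 := by
  have hp : IsSiegelDelta (maximalRealSubfield L) L (IsCMField.complexConj L) (complexConj_imagUnit L) (imagUnit_ne_zero L)
      (imagUnit_mul_self L) v n hT₀ rfl
      (1 * diagD (maximalRealSubfield L) L (IsCMField.complexConj L) v n hJ hJ' rfl g * 1) := by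
    rw [one_mul, mul_one]
    exact isSiegelDelta_diagD (maximalRealSubfield L) L (IsCMField.complexConj L) (complexConj_imagUnit L)
      (imagUnit_ne_zero L) (imagUnit_mul_self L) v n hT₀ hJ hJ' rfl g
  have h := apply_zero_toRep_mul_localSplitting_eq_mul L v μ n hT₀ hT₀d χ hχ m₀ hm₀ 1 (mul_one 1) _ hp Φ
  rw [map_one, mul_one, one_mul, mul_one] at h
  exact h

include hm₀ in
set_option maxHeartbeats 4000000 in -- the doubled CM datum's telescope (as in ★ `LocalSplittingCMParabolicEigenfunctional`)
/-- **THE DIAGONAL EIGEN-LAW ON PRODUCT VECTORS** («doubling see-saw kernel identity» at the group level): with the block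
restrictions `s₁ = restrictLeft s^𝔻` (on `U(T₀ ⊗ 1)`) and `s₂ = restrictRight s^𝔻` (on the second copy `U(−T₀ ⊗ 1) = U(T₀ ⊗ 1)`,
★ `BlockSum.toRep_inlLoc_mul_inrLoc_boxSB`),
`(ω^𝔻(m₀)(ω(s₁ g) f₁ ⊠ ω(s₂ g) f₂))(0) = χ_v(det_Δ i(g,g))⁻¹ · ∏_w ‖det_Δ i(g,g)_w‖^{1/2} · (ω^𝔻(m₀)(f₁ ⊠ f₂))(0)`.
[cite: Kudla1994, §3 Thm. 3.1] [cite: MoeglinVignerasWaldspurger1987, Chap. 2 II.1 Rem. (6)] -/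
theorem apply_zero_toRep_boxSB_restrict_diagD (g : localPi L (IsCMField.complexConj L) n J v)
    (f₁ f₂ : SchwartzBruhat (Fin n → v.adicCompletion (maximalRealSubfield L))) :
    ((MpPsi.toRep (localSchrodinger (maximalRealSubfield L) (n + n) (gramD (maximalRealSubfield L) n T₀) v) m₀
          (boxSB (v.adicCompletion (maximalRealSubfield L)) (e₂ n)
            (MpPsi.toRep (localSchrodinger (maximalRealSubfield L) n T₀ v)
              (BlockSum.restrictLeft (maximalRealSubfield L) L (IsCMField.complexConj L) v n n hJ
                (hJD_finSum (maximalRealSubfield L) L n rfl) (complexConj_imagUnit L) (imagUnit_ne_zero L) (imagUnit_mul_self L)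
                hT₀ hT₀.neg (isUnit_det_neg_of_isUnit (maximalRealSubfield L) n hT₀d)
                ((localSplittingDatumCM L v μ n hT₀ hT₀d rfl χ hχ).localSplitting)
                ((localSplittingDatumCM L v μ n hT₀ hT₀d rfl χ hχ).proj_localSplitting) g) f₁)
            (MpPsi.toRep (localSchrodinger (maximalRealSubfield L) n (-T₀) v)
              (BlockSum.restrictRight (maximalRealSubfield L) L (IsCMField.complexConj L) v n n hJ'
                (hJD_finSum (maximalRealSubfield L) L n rfl) (complexConj_imagUnit L) (imagUnit_ne_zero L) (imagUnit_mul_self L)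
                hT₀ hT₀.neg hT₀d
                ((localSplittingDatumCM L v μ n hT₀ hT₀d rfl χ hχ).localSplitting)
                ((localSplittingDatumCM L v μ n hT₀ hT₀d rfl χ hχ).proj_localSplitting)
                (toNegForm (maximalRealSubfield L) L (IsCMField.complexConj L) v n hJ hJ' g)) f₂)) :
        SchwartzBruhat (Fin (n + n) → v.adicCompletion (maximalRealSubfield L))) :
        (Fin (n + n) → v.adicCompletion (maximalRealSubfield L)) → ℂ) 0 =
      (((chiDet (maximalRealSubfield L) L (IsCMField.complexConj L) v n
            (fun w' : PlacesOver L v => (χ.localComponent w'.1)⁻¹)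
            (diagD (maximalRealSubfield L) L (IsCMField.complexConj L) v n hJ hJ' rfl g))⁻¹ : ℂˣ) : ℂ) *
        ((∏ w' : PlacesOver L v,
            Real.sqrt ‖detDelta (maximalRealSubfield L) L (IsCMField.complexConj L) v n w'
              (diagD (maximalRealSubfield L) L (IsCMField.complexConj L) v n hJ hJ' rfl g)‖ : ℝ) : ℂ) *
        ((MpPsi.toRep (localSchrodinger (maximalRealSubfield L) (n + n) (gramD (maximalRealSubfield L) n T₀) v) m₀
            (boxSB (v.adicCompletion (maximalRealSubfield L)) (e₂ n) f₁ f₂) :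
          SchwartzBruhat (Fin (n + n) → v.adicCompletion (maximalRealSubfield L))) :
          (Fin (n + n) → v.adicCompletion (maximalRealSubfield L)) → ℂ) 0 := by
  have h2 : MpPsi.toRep (localSchrodinger (maximalRealSubfield L) (n + n) (gramD (maximalRealSubfield L) n T₀) v)
      ((localSplittingDatumCM L v μ n hT₀ hT₀d rfl χ hχ).localSplitting
        (diagD (maximalRealSubfield L) L (IsCMField.complexConj L) v n hJ hJ' rfl g))
      (boxSB (v.adicCompletion (maximalRealSubfield L)) (e₂ n) f₁ f₂) =
      boxSB (v.adicCompletion (maximalRealSubfield L)) (e₂ n)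
        (MpPsi.toRep (localSchrodinger (maximalRealSubfield L) n T₀ v)
          (BlockSum.restrictLeft (maximalRealSubfield L) L (IsCMField.complexConj L) v n n hJ
            (hJD_finSum (maximalRealSubfield L) L n rfl) (complexConj_imagUnit L) (imagUnit_ne_zero L) (imagUnit_mul_self L)
            hT₀ hT₀.neg (isUnit_det_neg_of_isUnit (maximalRealSubfield L) n hT₀d)
            ((localSplittingDatumCM L v μ n hT₀ hT₀d rfl χ hχ).localSplitting)
            ((localSplittingDatumCM L v μ n hT₀ hT₀d rfl χ hχ).proj_localSplitting) g) f₁)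
        (MpPsi.toRep (localSchrodinger (maximalRealSubfield L) n (-T₀) v)
          (BlockSum.restrictRight (maximalRealSubfield L) L (IsCMField.complexConj L) v n n hJ'
            (hJD_finSum (maximalRealSubfield L) L n rfl) (complexConj_imagUnit L) (imagUnit_ne_zero L) (imagUnit_mul_self L)
            hT₀ hT₀.neg hT₀d
            ((localSplittingDatumCM L v μ n hT₀ hT₀d rfl χ hχ).localSplitting)
            ((localSplittingDatumCM L v μ n hT₀ hT₀d rfl χ hχ).proj_localSplitting)
            (toNegForm (maximalRealSubfield L) L (IsCMField.complexConj L) v n hJ hJ' g)) f₂) :=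
    BlockSum.toRep_inlLoc_mul_inrLoc_boxSB (maximalRealSubfield L) L (IsCMField.complexConj L) v n n hJ hJ'
      (hJD_finSum (maximalRealSubfield L) L n rfl) (complexConj_imagUnit L) (imagUnit_ne_zero L) (imagUnit_mul_self L)
      hT₀ hT₀.neg hT₀d (isUnit_det_neg_of_isUnit (maximalRealSubfield L) n hT₀d)
      ((localSplittingDatumCM L v μ n hT₀ hT₀d rfl χ hχ).localSplitting)
      ((localSplittingDatumCM L v μ n hT₀ hT₀d rfl χ hχ).proj_localSplitting) g _ f₁ f₂
  rw [← h2]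
  exact apply_zero_toRep_localSplitting_diagD L v μ n hT₀ hT₀d χ hχ m₀ hm₀ hJ hJ' g _

end CM

end Literature.NumberTheory.GelbartRogawski1991.UnitaryDualPair.LocalSplitting

end
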